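import Summits.AnomalousDissipation.AnomalousDissipation.Theorems.SawtoothPulseCascadeK1LocalisedCascadeSlotFibreSumFull

/-!
# K1loc, line `Spectral` / SeqCone — helper: FIBRE SUMMATION OF THE MAX-COMPATIBILITY TWO-STRIP ESTIMATE

Helper file of the prover lane on the crux `K1LocalisedCascade` (stmt-AnomalousDissipation-19491), route
`SawtoothPulseCascade` (memo v5 §4).  `…SlotFibreSum` / `…SlotFibreSumFull` sum over the fibres `k_i = n` an abstract
per-fibre two-strip estimate whose right side carries the TWO branch energies `Σ' m(k − b^±_n e_j)²|𝓕G|²`; the `√`-form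
then needs the sum-compatibility `m(k−b⁺e_j)² + m(k−b⁻e_j)² ≤ μ(k)²`.  Here the per-fibre hypothesis has the
MAX-compatibility shape produced by `…SlotFibreMax.tsum_symbol_sq_twoStrip_fibre_le_max` — ONE energy `Σ' ν²|𝓕G|²` of a
bounded symbol `ν` plus errors:
  `Σ' m²|𝓕((X⁺+X⁻)(x_j)·(G∘Φ))|² ≤ (√Σ' ν²|𝓕G|² + A‖G‖)² + 2C‖G‖²`   (every fibre `n`, every smooth `G` on it),
and the same inequality is deduced for EVERY smooth `θ` (`tsum_symbol_sq_twoStrip_le_of_band_of_fibre_max` for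
band-limited `θ` by orthogonality of fibres and finite Minkowski; `tsum_symbol_sq_twoStrip_le_of_fibre_max` by truncation,
as in `…SlotFibreSumFull`), with the `√`-form `sqrt_tsum_symbol_sq_twoStrip_le_of_fibre_max`:
  `‖m(D)((X⁺+X⁻)(x_j)·(θ∘Φ))‖ ≤ ‖ν(D)θ‖ + (A + √(2C))‖θ‖`.
No definitions; no statement about the stub.
[cite: Grafakos2014, Prop. 3.1.2 (5) (coefficients of products, translations and modulations) and Prop. 3.2.7 (3)
(Parseval)] [problem: turb]
-/

-- `Summit.<Summit>.<Problem>`: single-conjunct summit, the duplicate namespace segment is deliberate.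
set_option linter.dupNamespace false

noncomputable section

namespace Summit.AnomalousDissipation.AnomalousDissipation.Theorems.SawtoothPulseCascade.K1Slot

open MeasureTheory Set Filter Topology UnitAddTorus Function
open scoped ComplexConjugate
open Literature.Analysis Literature.Analysis.FunctionSpaces Literature.Analysis.FunctionSpaces.Torus
open Summit.AnomalousDissipation.AnomalousDissipation.Theorems.SawtoothPulseCascade.SpectralLeakage

variable {d : Type*} [Fintype d] [DecidableEq d]

/-! ## Band-limited case -/

/-- **Two-strip symbol energies summed over fibres, band-limited case, max-compatibility shape.**  Let `θ` be smooth
with its `i`-th frequencies in a finite set `s`, `Φ = shearMap i j P` (`i ≠ j`), `X⁺, X⁻` profiles read off `x_j`, `m`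
and `ν` bounded real symbols.  SUPPOSE for every `n ∈ s` and every smooth `G` with modes on the fibre `k_i = n`:
`Σ' m²|𝓕((X⁺+X⁻)(x_j)·(G∘Φ))|² ≤ (√Σ' ν²|𝓕G|² + A‖G‖)² + 2C‖G‖²`.  Then the same holds for `θ`:
`Σ'ₖ m_k² ‖𝓕((X⁺+X⁻)(x_j)·(θ∘Φ))(k)‖² ≤ (√Σ' ν²‖𝓕θ‖² + A‖θ‖)² + 2C∫‖θ‖²`
(fibre decomposition, orthogonality of fibres on both sides, finite Minkowski). [cite: Grafakos2014, Prop. 3.1.2 (5) and Prop. 3.2.7 (3)] -/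
theorem tsum_symbol_sq_twoStrip_le_of_band_of_fibre_max {θ : UnitAddTorus d → ℂ} {i j : d} (hθ : IsSmooth θ)
    (hij : i ≠ j) (s : Finset ℤ) (hband : ∀ k, mFourierCoeff θ k ≠ 0 → k i ∈ s) (P Xp Xm : ShearProfile)
    {m ν : (d → ℤ) → ℝ} {M M' : ℝ} (hmM : ∀ k, |m k| ≤ M) (hνM : ∀ k, |ν k| ≤ M') {A C : ℝ} (hA0 : 0 ≤ A)
    (hfib : ∀ n ∈ s, ∀ G : UnitAddTorus d → ℂ, IsSmooth G → (∀ k, mFourierCoeff G k ≠ 0 → k i = n) →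
      ∑' k, m k ^ 2 * ‖mFourierCoeff (fun x => ((Xp.onCircle (x j) : ℂ) + Xm.onCircle (x j)) * G (shearMap i j P x)) k‖ ^ 2 ≤
        (Real.sqrt (∑' k, ν k ^ 2 * ‖mFourierCoeff G k‖ ^ 2) + A * Real.sqrt (∫ x, ‖G x‖ ^ 2)) ^ 2 +
          2 * C * ∫ x, ‖G x‖ ^ 2) :
    ∑' k, m k ^ 2 * ‖mFourierCoeff (fun x => ((Xp.onCircle (x j) : ℂ) + Xm.onCircle (x j)) * θ (shearMap i j P x)) k‖ ^ 2 ≤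
      (Real.sqrt (∑' k, ν k ^ 2 * ‖mFourierCoeff θ k‖ ^ 2) + A * Real.sqrt (∫ x, ‖θ x‖ ^ 2)) ^ 2 +
        2 * C * ∫ x, ‖θ x‖ ^ 2 := by
  classical
  -- fibre pieces of `θ`
  set θn : ℤ → UnitAddTorus d → ℂ := fun n => modePiece (fibre i n) θ with hθn_def
  have hθn_smooth : ∀ n, IsSmooth (θn n) := fun n => isSmooth_modePiece hθ _
  have hθn_supp : ∀ n, ∀ k, mFourierCoeff (θn n) k ≠ 0 → k i = n := by
    intro n k hk
    rw [hθn_def, mFourierCoeff_modePiece hθ] at hk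
    by_contra h
    exact hk (Set.indicator_of_notMem (show k ∉ fibre i n from h) _)
  have hθsum : θ = ∑ n ∈ s, θn n :=
    eq_sum_modePiece hθ s (fibre i) (pairwiseDisjoint_fibre i _) fun k hk => ⟨k i, hband k hk, rfl⟩
  have hθfun : θ = fun x => ∑ n ∈ s, θn n x := by
    rw [hθsum]; funext x; exact Finset.sum_apply x s θn
  -- the pieces of `H = (X⁺+X⁻)(x_j)·(θ∘Φ)`
  set Hn : ℤ → UnitAddTorus d → ℂ := fun n x =>
    ((Xp.onCircle (x j) : ℂ) + Xm.onCircle (x j)) * θn n (shearMap i j P x) with hHn_def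
  have hΞ_smooth : IsSmooth (fun x : UnitAddTorus d => (Xp.onCircle (x j) : ℂ) + Xm.onCircle (x j)) :=
    (isSmooth_onCircle_comp' Xp j).ofReal_comp.add (isSmooth_onCircle_comp' Xm j).ofReal_comp
  have hΞ_inv : ∀ (t : UnitAddCircle) (x : UnitAddTorus d),
      ((Xp.onCircle ((x + Pi.single i t : UnitAddTorus d) j) : ℂ) +
          Xm.onCircle ((x + Pi.single i t : UnitAddTorus d) j)) =
        (Xp.onCircle (x j) : ℂ) + Xm.onCircle (x j) := fun t x => by
    simp [Pi.single_eq_of_ne hij.symm]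
  have hψn_smooth : ∀ n, IsSmooth (θn n ∘ shearMap i j P) := fun n => (hθn_smooth n).comp_shearMap i j P
  have hψn_supp : ∀ n, ∀ k, mFourierCoeff (θn n ∘ shearMap i j P) k ≠ 0 → k i = n := by
    intro n k hk
    by_contra h
    exact hk (mFourierCoeff_comp_shearMap_eq_zero_of_apply_not_mem (hθn_smooth n).continuous
      (hθn_smooth n).rapidDecay_mFourierCoeff.summable_norm hij P (A := {n})
      (fun k' hk' => not_not.1 fun h' => hk' (hθn_supp n k' h')) h)
  have hHn_smooth : ∀ n, IsSmooth (Hn n) := fun n => hΞ_smooth.mul (hψn_smooth n)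
  have hHn_supp : ∀ n, ∀ k, mFourierCoeff (Hn n) k ≠ 0 → k i = n := by
    intro n k hk
    by_contra h
    exact hk (mFourierCoeff_mul_eq_zero_of_fibre (θ := θn n ∘ shearMap i j P) hΞ_inv (hψn_smooth n) (hψn_supp n) h)
  have hH : (fun x => ((Xp.onCircle (x j) : ℂ) + Xm.onCircle (x j)) * θ (shearMap i j P x)) =
      fun x => ∑ n ∈ s, Hn n x := by
    funext x
    rw [hθfun]
    simp only [hHn_def, Finset.mul_sum]
  -- fibrewise weighted Parseval for `H` and for `θ` with the symbol `ν`
  obtain ⟨_, hHeq⟩ := tsum_symbol_sq_sum_eq_of_fibre i s (f := Hn) (fun n _ => hHn_smooth n)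
    (fun n _ => hHn_supp n) hmM
  obtain ⟨_, hθνeq⟩ := tsum_symbol_sq_sum_eq_of_fibre i s (f := θn) (fun n _ => hθn_smooth n)
    (fun n _ => hθn_supp n) hνM
  -- per-fibre quantities
  set a : ℤ → ℝ := fun n => Real.sqrt (∑' k, ν k ^ 2 * ‖mFourierCoeff (θn n) k‖ ^ 2) with ha_def
  set g : ℤ → ℝ := fun n => Real.sqrt (∫ x, ‖θn n x‖ ^ 2) with hg_def
  have hg0 : ∀ n, 0 ≤ g n := fun n => Real.sqrt_nonneg _
  have hg2 : ∀ n, g n ^ 2 = ∫ x, ‖θn n x‖ ^ 2 := fun n => Real.sq_sqrt (integral_nonneg fun x => by positivity)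
  -- the per-fibre estimate
  have hfib' : ∀ n ∈ s, ∑' k, m k ^ 2 * ‖mFourierCoeff (Hn n) k‖ ^ 2 ≤ (a n + A * g n) ^ 2 + 2 * C * g n ^ 2 := by
    intro n hn
    have h := hfib n hn (θn n) (hθn_smooth n) (hθn_supp n)
    have han : Real.sqrt (∑' k, ν k ^ 2 * ‖mFourierCoeff (θn n) k‖ ^ 2) = a n := rfl
    have hgn : Real.sqrt (∫ x, ‖θn n x‖ ^ 2) = g n := rfl
    rw [han, hgn, ← hg2 n] at h
    exact h
  -- Parseval across fibres for the `L²` norms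
  have hL2 : ∑ n ∈ s, ∫ x, ‖θn n x‖ ^ 2 = ∫ x, ‖θ x‖ ^ 2 := by
    rw [← integral_norm_sq_sum_eq_of_fibre i s (fun n _ => hθn_smooth n) (fun n _ => hθn_supp n)]
    have hint : (fun x => ‖θ x‖ ^ 2) = fun x => ‖∑ n ∈ s, θn n x‖ ^ 2 := by
      funext x; rw [hθfun]
    rw [hint]
  have hg_sq : ∑ n ∈ s, g n ^ 2 = ∫ x, ‖θ x‖ ^ 2 := by
    rw [← hL2]; exact Finset.sum_congr rfl fun n _ => hg2 n
  have hAg_sq : Real.sqrt (∑ n ∈ s, (A * g n) ^ 2) = A * Real.sqrt (∫ x, ‖θ x‖ ^ 2) := by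
    have h : ∑ n ∈ s, (A * g n) ^ 2 = A ^ 2 * ∫ x, ‖θ x‖ ^ 2 := by
      rw [← hg_sq, Finset.mul_sum]
      exact Finset.sum_congr rfl fun n _ => by ring
    rw [h, Real.sqrt_mul' _ (integral_nonneg fun x => by positivity), Real.sqrt_sq hA0]
  have ha_sq : ∑ n ∈ s, a n ^ 2 = ∑' k, ν k ^ 2 * ‖mFourierCoeff θ k‖ ^ 2 := by
    rw [show (∑' k, ν k ^ 2 * ‖mFourierCoeff θ k‖ ^ 2) = ∑ n ∈ s, ∑' k, ν k ^ 2 * ‖mFourierCoeff (θn n) k‖ ^ 2 by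
      rw [← hθνeq, ← hθfun]]
    exact Finset.sum_congr rfl fun n _ => Real.sq_sqrt (tsum_nonneg fun k => by positivity)
  -- assemble
  have hMa : ∑ n ∈ s, (a n + A * g n) ^ 2 ≤
      (Real.sqrt (∑' k, ν k ^ 2 * ‖mFourierCoeff θ k‖ ^ 2) + A * Real.sqrt (∫ x, ‖θ x‖ ^ 2)) ^ 2 := by
    have h := sum_add_sq_le s (a := a) (b := fun n => A * g n) (fun n _ => Real.sqrt_nonneg _)
      (fun n _ => mul_nonneg hA0 (hg0 n))
    rwa [ha_sq, hAg_sq] at h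
  have hMc : ∑ n ∈ s, 2 * C * g n ^ 2 = 2 * C * ∫ x, ‖θ x‖ ^ 2 := by
    rw [← hg_sq, Finset.mul_sum]
  calc ∑' k, m k ^ 2 * ‖mFourierCoeff (fun x => ((Xp.onCircle (x j) : ℂ) + Xm.onCircle (x j)) *
          θ (shearMap i j P x)) k‖ ^ 2
      = ∑ n ∈ s, ∑' k, m k ^ 2 * ‖mFourierCoeff (Hn n) k‖ ^ 2 := by rw [hH, hHeq]
    _ ≤ ∑ n ∈ s, ((a n + A * g n) ^ 2 + 2 * C * g n ^ 2) := Finset.sum_le_sum hfib'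
    _ = ∑ n ∈ s, (a n + A * g n) ^ 2 + ∑ n ∈ s, 2 * C * g n ^ 2 := by rw [Finset.sum_add_distrib]
    _ ≤ _ := by rw [hMc]; linarith

/-! ## Every smooth function -/

/-- **Two-strip symbol energies for every smooth function, max-compatibility shape**, from the per-fibre estimate on ALL
fibres: the band limitation is removed by truncation (every finite partial sum of the left side is a partial sum for a
band-limited truncation, the right side is monotone in the band), exactly as in
`…SlotFibreSumFull.tsum_symbol_sq_twoStrip_le_of_fibre`. [cite: Grafakos2014, Prop. 3.1.2 (5) and Prop. 3.2.7 (3)] -/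
theorem tsum_symbol_sq_twoStrip_le_of_fibre_max {θ : UnitAddTorus d → ℂ} {i j : d} (hθ : IsSmooth θ) (hij : i ≠ j)
    (P Xp Xm : ShearProfile) {m ν : (d → ℤ) → ℝ} {M M' : ℝ} (hmM : ∀ k, |m k| ≤ M) (hνM : ∀ k, |ν k| ≤ M')
    {A C : ℝ} (hA0 : 0 ≤ A) (hC0 : 0 ≤ C)
    (hfib : ∀ n : ℤ, ∀ G : UnitAddTorus d → ℂ, IsSmooth G → (∀ k, mFourierCoeff G k ≠ 0 → k i = n) →
      ∑' k, m k ^ 2 * ‖mFourierCoeff (fun x => ((Xp.onCircle (x j) : ℂ) + Xm.onCircle (x j)) * G (shearMap i j P x)) k‖ ^ 2 ≤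
        (Real.sqrt (∑' k, ν k ^ 2 * ‖mFourierCoeff G k‖ ^ 2) + A * Real.sqrt (∫ x, ‖G x‖ ^ 2)) ^ 2 +
          2 * C * ∫ x, ‖G x‖ ^ 2) :
    ∑' k, m k ^ 2 * ‖mFourierCoeff (fun x => ((Xp.onCircle (x j) : ℂ) + Xm.onCircle (x j)) * θ (shearMap i j P x)) k‖ ^ 2 ≤
      (Real.sqrt (∑' k, ν k ^ 2 * ‖mFourierCoeff θ k‖ ^ 2) + A * Real.sqrt (∫ x, ‖θ x‖ ^ 2)) ^ 2 +
        2 * C * ∫ x, ‖θ x‖ ^ 2 := by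
  classical
  -- the multiplier `Ξ = (X⁺+X⁻)(x_j)` as a function of one coordinate
  set Gc : UnitAddCircle → ℂ := fun b => (Xp.onCircle b : ℂ) + Xm.onCircle b with hGc_def
  have hGc : Continuous Gc :=
    (Complex.continuous_ofReal.comp Xp.continuous_onCircle).add (Complex.continuous_ofReal.comp Xm.continuous_onCircle)
  have hΞ_smooth : IsSmooth (fun x : UnitAddTorus d => Gc (x j)) :=
    (isSmooth_onCircle_comp' Xp j).ofReal_comp.add (isSmooth_onCircle_comp' Xm j).ofReal_comp
  have hGs : Summable fun q => ‖mFourierCoeff (fun x : UnitAddTorus d => Gc (x j)) q‖ :=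
    hΞ_smooth.rapidDecay_mFourierCoeff.summable_norm
  have hHfun : (fun x => ((Xp.onCircle (x j) : ℂ) + Xm.onCircle (x j)) * θ (shearMap i j P x)) =
      fun x => Gc (x j) * θ (shearMap i j P x) := rfl
  have hH_c : Continuous fun x => Gc (x j) * θ (shearMap i j P x) :=
    hΞ_smooth.continuous.mul (hθ.comp_shearMap i j P).continuous
  -- the right-hand side
  set g := Real.sqrt (∫ x, ‖θ x‖ ^ 2) with hg
  set a := Real.sqrt (∑' k, ν k ^ 2 * ‖mFourierCoeff θ k‖ ^ 2) with ha
  set R : ℝ := (a + A * g) ^ 2 + 2 * C * ∫ x, ‖θ x‖ ^ 2 with hR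
  have hParsθ := hasSum_sq_mFourierCoeff_of_continuous hθ.continuous
  have hwν := summable_symbol_sq hθ.continuous hνM
  have hwH := summable_symbol_sq hH_c hmM
  -- every finite partial sum of the left side is bounded by `R`
  have hfin : ∀ T : Finset (d → ℤ), ∑ k ∈ T, m k ^ 2 * ‖mFourierCoeff (fun x => Gc (x j) * θ (shearMap i j P x)) k‖ ^ 2 ≤ R := by
    intro T
    obtain ⟨N, hN⟩ : ∃ N : ℕ, ∀ k ∈ T, |k i| ≤ (N : ℤ) := by
      refine ⟨T.sup fun k => (k i).natAbs, fun k hk => ?_⟩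
      have h1 : (k i).natAbs ≤ T.sup fun k => (k i).natAbs := Finset.le_sup (f := fun k => (k i).natAbs) hk
      calc |k i| = ((k i).natAbs : ℤ) := (Int.natCast_natAbs (k i)).symm
        _ ≤ _ := by exact_mod_cast h1
    set B : Set (d → ℤ) := {k : d → ℤ | |k i| ≤ (N : ℤ)} with hB
    set θN : UnitAddTorus d → ℂ := modePiece B θ with hθN
    have hθN_smooth : IsSmooth θN := isSmooth_modePiece hθ B
    have hθN_coeff : ∀ k, mFourierCoeff θN k = B.indicator (mFourierCoeff θ) k := mFourierCoeff_modePiece hθ B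
    have hband : ∀ k, mFourierCoeff θN k ≠ 0 → k i ∈ Finset.Icc (-(N : ℤ)) N := by
      intro k hk
      rw [hθN_coeff] at hk
      have hkB : k ∈ B := by
        by_contra h; exact hk (Set.indicator_of_notMem h _)
      rw [Finset.mem_Icc]
      exact abs_le.mp hkB
    -- the band-limited lemma for `θN`
    have hBL := tsum_symbol_sq_twoStrip_le_of_band_of_fibre_max hθN_smooth hij (Finset.Icc (-(N : ℤ)) N) hband P Xp Xm
      hmM hνM hA0 (C := C) (fun n _ => hfib n)
    -- monotonicity of the right side in the truncation
    have hcoeff_le : ∀ k, ‖mFourierCoeff θN k‖ ^ 2 ≤ ‖mFourierCoeff θ k‖ ^ 2 := fun k => by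
      rw [hθN_coeff, norm_indicator_eq_indicator_norm]
      exact pow_le_pow_left₀ (Set.indicator_nonneg (fun _ _ => norm_nonneg _) k)
        (Set.indicator_le_self' (fun _ _ => norm_nonneg _) k) 2
    have hParsN := hasSum_sq_mFourierCoeff_of_continuous hθN_smooth.continuous
    have h1 : ∑' k, ν k ^ 2 * ‖mFourierCoeff θN k‖ ^ 2 ≤ ∑' k, ν k ^ 2 * ‖mFourierCoeff θ k‖ ^ 2 :=
      (summable_symbol_sq hθN_smooth.continuous hνM).tsum_le_tsum
        (fun k => mul_le_mul_of_nonneg_left (hcoeff_le k) (sq_nonneg _)) hwν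
    have h2 : ∫ x, ‖θN x‖ ^ 2 ≤ ∫ x, ‖θ x‖ ^ 2 := by
      rw [← hParsN.tsum_eq, ← hParsθ.tsum_eq]
      exact hParsN.summable.tsum_le_tsum hcoeff_le hParsθ.summable
    have hgN : Real.sqrt (∫ x, ‖θN x‖ ^ 2) ≤ g := Real.sqrt_le_sqrt h2
    have haN : Real.sqrt (∑' k, ν k ^ 2 * ‖mFourierCoeff θN k‖ ^ 2) ≤ a := Real.sqrt_le_sqrt h1
    have hRN : (Real.sqrt (∑' k, ν k ^ 2 * ‖mFourierCoeff θN k‖ ^ 2) + A * Real.sqrt (∫ x, ‖θN x‖ ^ 2)) ^ 2 +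
        2 * C * ∫ x, ‖θN x‖ ^ 2 ≤ R := by
      have hq1 : (Real.sqrt (∑' k, ν k ^ 2 * ‖mFourierCoeff θN k‖ ^ 2) + A * Real.sqrt (∫ x, ‖θN x‖ ^ 2)) ^ 2 ≤
          (a + A * g) ^ 2 :=
        pow_le_pow_left₀ (add_nonneg (Real.sqrt_nonneg _) (mul_nonneg hA0 (Real.sqrt_nonneg _)))
          (add_le_add haN (mul_le_mul_of_nonneg_left hgN hA0)) 2
      have hq3 : 2 * C * ∫ x, ‖θN x‖ ^ 2 ≤ 2 * C * ∫ x, ‖θ x‖ ^ 2 :=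
        mul_le_mul_of_nonneg_left h2 (by positivity)
      rw [hR]; linarith
    -- the partial sum over `T` is a partial sum for `θN`
    have hHN_c : Continuous fun x => Gc (x j) * θN (shearMap i j P x) :=
      hΞ_smooth.continuous.mul (hθN_smooth.comp_shearMap i j P).continuous
    have hwN := summable_symbol_sq hHN_c hmM
    have hT : ∑ k ∈ T, m k ^ 2 * ‖mFourierCoeff (fun x => Gc (x j) * θ (shearMap i j P x)) k‖ ^ 2 =
        ∑ k ∈ T, m k ^ 2 * ‖mFourierCoeff (fun x => Gc (x j) * θN (shearMap i j P x)) k‖ ^ 2 :=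
      Finset.sum_congr rfl fun k hk => by
        rw [hθN, mFourierCoeff_evalMul_comp_shearMap_modePiece_eq hθ hij P hGc hGs N (hN k hk)]
    have hBL' : ∑' k, m k ^ 2 * ‖mFourierCoeff (fun x => Gc (x j) * θN (shearMap i j P x)) k‖ ^ 2 ≤ R :=
      hBL.trans hRN
    calc ∑ k ∈ T, m k ^ 2 * ‖mFourierCoeff (fun x => Gc (x j) * θ (shearMap i j P x)) k‖ ^ 2
        = ∑ k ∈ T, m k ^ 2 * ‖mFourierCoeff (fun x => Gc (x j) * θN (shearMap i j P x)) k‖ ^ 2 := hT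
      _ ≤ ∑' k, m k ^ 2 * ‖mFourierCoeff (fun x => Gc (x j) * θN (shearMap i j P x)) k‖ ^ 2 :=
          hwN.sum_le_tsum T fun k _ => by positivity
      _ ≤ R := hBL'
  rw [hHfun]
  exact hwH.tsum_le_of_sum_le hfin

/-- **The half-slot un-gauging step in `√`-form, every smooth function, max-compatibility shape**:
`‖m(D)((X⁺+X⁻)(x_j)·(θ∘Φ))‖ ≤ ‖ν(D)θ‖ + (A + √(2C))‖θ‖`.  With the per-fibre estimate of
`…SlotFibreMax.tsum_symbol_sq_twoStrip_fibre_le_max` (`ν = μ` the old symbol, `A = √(A⁺²+A⁻²)`) this is the two-strip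
step under the MAX-compatibility `m(k − b^σ_{k_i} e_j)² ≤ μ(k)²` for each `σ`. [cite: Grafakos2014, Prop. 3.1.2 (5) and Prop. 3.2.7 (3)] -/
theorem sqrt_tsum_symbol_sq_twoStrip_le_of_fibre_max {θ : UnitAddTorus d → ℂ} {i j : d} (hθ : IsSmooth θ) (hij : i ≠ j)
    (P Xp Xm : ShearProfile) {m ν : (d → ℤ) → ℝ} {M M' : ℝ} (hmM : ∀ k, |m k| ≤ M) (hνM : ∀ k, |ν k| ≤ M')
    {A C : ℝ} (hA0 : 0 ≤ A) (hC0 : 0 ≤ C)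
    (hfib : ∀ n : ℤ, ∀ G : UnitAddTorus d → ℂ, IsSmooth G → (∀ k, mFourierCoeff G k ≠ 0 → k i = n) →
      ∑' k, m k ^ 2 * ‖mFourierCoeff (fun x => ((Xp.onCircle (x j) : ℂ) + Xm.onCircle (x j)) * G (shearMap i j P x)) k‖ ^ 2 ≤
        (Real.sqrt (∑' k, ν k ^ 2 * ‖mFourierCoeff G k‖ ^ 2) + A * Real.sqrt (∫ x, ‖G x‖ ^ 2)) ^ 2 +
          2 * C * ∫ x, ‖G x‖ ^ 2) :
    Real.sqrt (∑' k, m k ^ 2 *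
        ‖mFourierCoeff (fun x => ((Xp.onCircle (x j) : ℂ) + Xm.onCircle (x j)) * θ (shearMap i j P x)) k‖ ^ 2) ≤
      Real.sqrt (∑' k, ν k ^ 2 * ‖mFourierCoeff θ k‖ ^ 2) + (A + Real.sqrt (2 * C)) * Real.sqrt (∫ x, ‖θ x‖ ^ 2) := by
  have hmain := tsum_symbol_sq_twoStrip_le_of_fibre_max hθ hij P Xp Xm hmM hνM hA0 hC0 hfib
  set a := Real.sqrt (∑' k, ν k ^ 2 * ‖mFourierCoeff θ k‖ ^ 2) with ha
  set g := Real.sqrt (∫ x, ‖θ x‖ ^ 2) with hg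
  have ha0 : 0 ≤ a := Real.sqrt_nonneg _
  have hg0 : 0 ≤ g := Real.sqrt_nonneg _
  have hg2 : g ^ 2 = ∫ x, ‖θ x‖ ^ 2 := Real.sq_sqrt (integral_nonneg fun x => by positivity)
  have hc2 : (Real.sqrt (2 * C) * g) ^ 2 = 2 * C * ∫ x, ‖θ x‖ ^ 2 := by
    rw [mul_pow, Real.sq_sqrt (by positivity), hg2]
  rw [← hc2] at hmain
  -- `x ≤ p² + q²  ⇒  √x ≤ p + q`
  have hpq : (a + A * g) ^ 2 + (Real.sqrt (2 * C) * g) ^ 2 ≤ (a + A * g + Real.sqrt (2 * C) * g) ^ 2 := by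
    nlinarith [mul_nonneg (add_nonneg ha0 (mul_nonneg hA0 hg0)) (mul_nonneg (Real.sqrt_nonneg (2 * C)) hg0)]
  calc Real.sqrt (∑' k, m k ^ 2 *
          ‖mFourierCoeff (fun x => ((Xp.onCircle (x j) : ℂ) + Xm.onCircle (x j)) * θ (shearMap i j P x)) k‖ ^ 2)
      ≤ Real.sqrt ((a + A * g + Real.sqrt (2 * C) * g) ^ 2) := Real.sqrt_le_sqrt (hmain.trans hpq)
    _ = a + A * g + Real.sqrt (2 * C) * g :=
        Real.sqrt_sq (add_nonneg (add_nonneg ha0 (mul_nonneg hA0 hg0)) (mul_nonneg (Real.sqrt_nonneg _) hg0))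
    _ = a + (A + Real.sqrt (2 * C)) * g := by ring

end Summit.AnomalousDissipation.AnomalousDissipation.Theorems.SawtoothPulseCascade.K1Slot
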